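import Summits.BirchSwinnertonDyer.Rank1Residual.X12.SexticTwistFamilyRecords
import Summits.BirchSwinnertonDyer.Rank1Residual.X12.SexticTwistBeyondWindowCurvesA
import Summits.BirchSwinnertonDyer.Rank1Residual.X12.SexticTwistBeyondWindowClassNumbers
import HarnessLib

/-!
# X12, `p = 3`, Kriz–Li corner beyond the window (records A): `BSD(E, 3)` for eight T-KL classes `49923e … 176400jw` from the family theorem

HONEST FRAMING (cell `b2b-bsdres`, run/shared/lean/b2b/bsd-rank1-residual/; X12 prover owner
`b2b-bsdres-x1b`, gen 18): the goal is to DELETE the COMBINATION-SHAPED residual classes for ALL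
analytic-rank `≤ 1` curves over `ℚ` — "full BSD formula for every rank `≤ 1` curve in class `C`"
assembled STRICTLY from published theorems — so that the rank-`≤ 1` remainder becomes exactly the
CONSTRUCTION-SHAPED classes, which are TYPED (missing-input Props), NOT attempted; this is not
"finishing BSD". Class X12 stays CONSTRUCTION-SHAPED; the Kriz–Li sextic-twist corner at `p = 3` is
FAMILY-shaped and this file is PER CLASS (VALUE beyond the census window `N < 2·10⁴`; nothing is
booked here — the lane books, the referees rule). THEOREMS ONLY: no definition, NO new named fact
(net Literature debt `0`).

For each of the eight classes of `SexticTwistBeyondWindowCurvesA` (hyp RAM3 §3: every binder of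
Kriz–Li 2019 Thm. 1.23 + Cor. 10.7 (2) met; engines A ‖ P agree) the class record
`SexticTwistFamily.record_of_family` (gen 18, = the family theorem `bsdp_three_sexticTwist_family`
of gen 17 + Cassels) is instantiated: **`BSD(…2, 3)`, `Ш(…2/ℚ)` finite, `r_an(…2) = rank …2(ℚ) = 1`,
and `BSD(…1, 3)`, `r_an(…1) = 1`**, from the PUBLISHED named facts taken as hypotheses (Kriz–Li
Thm. 10.10 `h`, Cor. 10.7 `h107`, Thm. 9.4 `h94`; Gross–Zagier `hGZ`, Kolyvagin `hKo`, `K`-rationality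
of Heegner points `hrat` — each for every level/curve/field; Burungale–Flach 2024 Cor. 2 `hCM0`;
modularity `hmod`; Cassels `hCassels`) and exactly TWO per-class data: `hDt` — a level-`N`
parametrisation of `…2 ≅ E_d` with Manin constant prime to `3` (Kriz–Li's hypothesis (4); Cremona
`opt_man`: `c = 1` for both members, the optimal one `…1` covered in print by Agashe–Ribet–Stein–Cremona
2006 Thm. 2.6 for `N ≤ 130000`) — and `hN : N(…2) = N` (Cremona's table). Kriz–Li's (1) `d`
fundamental, (2) `d mod 9`, Cor. 10.7's case (2) are decided by `norm_num`; (3a) is the kernel theorem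
`threeClassNumberTrivial_neg<D>` of `SexticTwistBeyondWindowClassNumbers`.

| class | `d` | case (2) | (3a) | `N` |
|---|---|---|---|---|
| 49923e | `−43` | `d < 0`, `−43 ≡ 2 (9)` | `h₃(−43)`: `h = 1` | `49923` |
| 52272bm | `44` | `44 ≡ 8 (9)` | `h₃(−132)`: `h = 4` | `52272` |
| 73008cn | `−52` | `d < 0`, `≡ 2 (9)` | `h₃(−52)`: `h = 2` | `73008` |
| 75843b | `53` | `≡ 8 (9)` | `h₃(−159)`: `h = 10` | `75843` |
| 87723n | `57` | `≡ 3 (9)` | `h₃(−171)`: `h(−19) = 1` | `87723` |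
| 97344a | `104` | `≡ 5 (9)` | `h₃(−312)`: `h = 4` | `97344` |
| 168507b | `−79` | `d < 0`, `≡ 2 (9)` | `h₃(−79)`: `h = 5` | `168507` |
| 176400jw | `140` | `≡ 5 (9)` | `h₃(−420)`: `h = 8` | `176400` |

## References
* [KrizLi2019] D. Kriz, C. Li, Forum Math. Sigma 7 (2019) e15, Thm. 1.23 = Thm. 10.10, Cor. 10.7 (2), Thm. 9.4.
* [BurungaleFlach2024] Camb. J. Math. 12 (2024), Cor. 2. [MilneADT2006] Thm. I.7.3 (Cassels). [Miller2011LMS] Def. 1.1.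
* [Cremona1997] `ecdata/allcurves`, `allisog`, `opt_man` (the eight classes). [AgasheRibetStein2006] Thm. 2.6 / Thm. 5.2.
* HOME/b2b-bsdres-hyp/hyp/ram3/RAM3-CENSUS.md §3; HOME/b2b-bsdres-x1b/X12-ROUTE.md §22.
-/

set_option autoImplicit false

noncomputable section

open scoped Classical NumberField

open WeierstrassCurve NumberField Literature.NumberTheory.EllipticCurves
  Literature.NumberTheory.EllipticCurves.ModularForms
  Literature.NumberTheory.EllipticCurves.KrizLi2019
  Literature.NumberTheory.EllipticCurves.Rank1Residual
  Literature.NumberTheory.EllipticCurves.Rank1Residual.X12SexticTwist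

namespace Summit.BirchSwinnertonDyer.Rank1Residual.X12.SexticTwistFamily

/-- **`49923e` (`d = −43`)**: `49923e2 = [0,0,1,0,290] ≅ E_{−43}`, `49923e1 ~ 49923e2`. Per-class inputs
`hDt` (Manin prime to `3` at level `49923`) and `hN`. (1) `−43 ≡ 1 (4)` prime; case (2) `d < 0`,
`−43 ≡ 2 (9)`; (3a) `h₃(−43) = 1`. [cite: KrizLi2019, Thm. 1.23 = Thm. 10.10 and Cor. 10.7 (2)]
[cite: Cremona1997, ecdata/allcurves (class 49923e)] -/
theorem bsdp_three_cremona49923e_of_family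
    (h : thm1010_bsdThree_overK_sexticTwist) (h107 : cor107_analyticRank_sexticTwist)
    (h94 : thm94_exists_heegnerField_h3_eq_one)
    (hGZ : ∀ (N : ℕ) [NeZero N] (W : WeierstrassCurve ℚ) (K : Type) [Field K] [NumberField K],
      gross_zagier N W K)
    (hKo : ∀ (N : ℕ) [NeZero N] (W : WeierstrassCurve ℚ) (K : Type) [Field K] [NumberField K],
      kolyvagin N W K)
    (hrat : ∀ (N : ℕ) [NeZero N] (W : WeierstrassCurve ℚ) (K : Type) [Field K] [NumberField K],
      heegnerPointComplex_mem_range_map N W K)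
    (hCM0 : bsdTriple_of_hasCM_of_L_one_ne_zero) (hmod : hasEntireLFunction_rat)
    (hCassels : bsdRHS_eq_of_isIsogenous)
    (hDt : ∃ Dt : ModularParametrizationData cremona49923e2 49923, ¬ (3 : ℤ) ∣ Dt.c)
    (hN : cremona49923e2.conductorNorm ℤ = 49923) :
    (BSDp cremona49923e2 3 ∧ cremona49923e2.ShaFinite ∧ cremona49923e2.analyticRank = 1 ∧
        cremona49923e2.mordellWeilRank = 1) ∧
      (BSDp cremona49923e1 3 ∧ cremona49923e1.analyticRank = 1) := by
  haveI : NeZero (49923 : ℕ) := ⟨by norm_num⟩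
  refine record_of_family h h107 h94 hGZ hKo hrat hCM0 hmod hCassels (-43) cremona49923e2 49923
    cremona49923e2_eq hN ?_ (by norm_num) ?_ (by norm_num) hDt cremona49923e1 isIsogenous_cremona49923e
  · exact Or.inl ⟨by norm_num,
      by simpa using squarefree_neg_natCast (by norm_num : Nat.Prime 43).squarefree, by norm_num⟩
  · exact ⟨fun h => absurd h (by norm_num), fun _ => threeClassNumberTrivial_neg43⟩

/-- **`52272bm` (`d = 44`)**: `52272bm2 = [0,0,0,0,−297] ≅ E_{44}`, `52272bm1 ~ 52272bm2`. Inputs `hDt`,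
`hN`. (1) `44 = 4·11`, `11 ≡ 3 (4)`; `44 ≡ 8 (9)`; (3a) `h₃(−132) = 1` (`h = 4`).
[cite: KrizLi2019, Thm. 1.23 = Thm. 10.10 and Cor. 10.7 (2)] [cite: Cremona1997, ecdata/allcurves (class 52272bm)] -/
theorem bsdp_three_cremona52272bm_of_family
    (h : thm1010_bsdThree_overK_sexticTwist) (h107 : cor107_analyticRank_sexticTwist)
    (h94 : thm94_exists_heegnerField_h3_eq_one)
    (hGZ : ∀ (N : ℕ) [NeZero N] (W : WeierstrassCurve ℚ) (K : Type) [Field K] [NumberField K],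
      gross_zagier N W K)
    (hKo : ∀ (N : ℕ) [NeZero N] (W : WeierstrassCurve ℚ) (K : Type) [Field K] [NumberField K],
      kolyvagin N W K)
    (hrat : ∀ (N : ℕ) [NeZero N] (W : WeierstrassCurve ℚ) (K : Type) [Field K] [NumberField K],
      heegnerPointComplex_mem_range_map N W K)
    (hCM0 : bsdTriple_of_hasCM_of_L_one_ne_zero) (hmod : hasEntireLFunction_rat)
    (hCassels : bsdRHS_eq_of_isIsogenous)
    (hDt : ∃ Dt : ModularParametrizationData cremona52272bm2 52272, ¬ (3 : ℤ) ∣ Dt.c)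
    (hN : cremona52272bm2.conductorNorm ℤ = 52272) :
    (BSDp cremona52272bm2 3 ∧ cremona52272bm2.ShaFinite ∧ cremona52272bm2.analyticRank = 1 ∧
        cremona52272bm2.mordellWeilRank = 1) ∧
      (BSDp cremona52272bm1 3 ∧ cremona52272bm1.analyticRank = 1) := by
  haveI : NeZero (52272 : ℕ) := ⟨by norm_num⟩
  refine record_of_family h h107 h94 hGZ hKo hrat hCM0 hmod hCassels 44 cremona52272bm2 52272
    cremona52272bm2_eq hN ?_ (by norm_num) ?_ (by norm_num) hDt cremona52272bm1
    isIsogenous_cremona52272bm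
  · refine Or.inr ⟨by norm_num, by norm_num, ?_⟩
    rw [show ((44 : ℤ) / 4) = 11 by norm_num]
    exact squarefree_intCast_of_prime (by norm_num : Nat.Prime 11)
  · exact ⟨fun _ => by norm_num; exact threeClassNumberTrivial_neg132, fun h => absurd h (by norm_num)⟩

/-- **`73008cn` (`d = −52`)**: `73008cn2 = [0,0,0,0,351] ≅ E_{−52}`, `73008cn1 ~ 73008cn2`. Inputs `hDt`,
`hN`. (1) `−52 = 4·(−13)`, `−13 ≡ 3 (4)`; case (2) `d < 0`, `−52 ≡ 2 (9)`; (3a) `h₃(−52) = 1` (`h = 2`).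
[cite: KrizLi2019, Thm. 1.23 = Thm. 10.10 and Cor. 10.7 (2)] [cite: Cremona1997, ecdata/allcurves (class 73008cn)] -/
theorem bsdp_three_cremona73008cn_of_family
    (h : thm1010_bsdThree_overK_sexticTwist) (h107 : cor107_analyticRank_sexticTwist)
    (h94 : thm94_exists_heegnerField_h3_eq_one)
    (hGZ : ∀ (N : ℕ) [NeZero N] (W : WeierstrassCurve ℚ) (K : Type) [Field K] [NumberField K],
      gross_zagier N W K)
    (hKo : ∀ (N : ℕ) [NeZero N] (W : WeierstrassCurve ℚ) (K : Type) [Field K] [NumberField K],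
      kolyvagin N W K)
    (hrat : ∀ (N : ℕ) [NeZero N] (W : WeierstrassCurve ℚ) (K : Type) [Field K] [NumberField K],
      heegnerPointComplex_mem_range_map N W K)
    (hCM0 : bsdTriple_of_hasCM_of_L_one_ne_zero) (hmod : hasEntireLFunction_rat)
    (hCassels : bsdRHS_eq_of_isIsogenous)
    (hDt : ∃ Dt : ModularParametrizationData cremona73008cn2 73008, ¬ (3 : ℤ) ∣ Dt.c)
    (hN : cremona73008cn2.conductorNorm ℤ = 73008) :
    (BSDp cremona73008cn2 3 ∧ cremona73008cn2.ShaFinite ∧ cremona73008cn2.analyticRank = 1 ∧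
        cremona73008cn2.mordellWeilRank = 1) ∧
      (BSDp cremona73008cn1 3 ∧ cremona73008cn1.analyticRank = 1) := by
  haveI : NeZero (73008 : ℕ) := ⟨by norm_num⟩
  refine record_of_family h h107 h94 hGZ hKo hrat hCM0 hmod hCassels (-52) cremona73008cn2 73008
    cremona73008cn2_eq hN ?_ (by norm_num) ?_ (by norm_num) hDt cremona73008cn1
    isIsogenous_cremona73008cn
  · refine Or.inr ⟨by norm_num, by norm_num, ?_⟩
    rw [show ((-52 : ℤ) / 4) = -13 by norm_num]
    simpa using squarefree_neg_natCast (by norm_num : Nat.Prime 13).squarefree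
  · exact ⟨fun h => absurd h (by norm_num), fun _ => threeClassNumberTrivial_neg52⟩

/-- **`75843b` (`d = 53`)**: `75843b2 = [0,0,1,0,−358] ≅ E_{53}`, `75843b1 ~ 75843b2`. Inputs `hDt`, `hN`.
(1) `53 ≡ 1 (4)` prime; `53 ≡ 8 (9)`; (3a) `h₃(−159) = 1` (`h = 10`).
[cite: KrizLi2019, Thm. 1.23 = Thm. 10.10 and Cor. 10.7 (2)] [cite: Cremona1997, ecdata/allcurves (class 75843b)] -/
theorem bsdp_three_cremona75843b_of_family
    (h : thm1010_bsdThree_overK_sexticTwist) (h107 : cor107_analyticRank_sexticTwist)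
    (h94 : thm94_exists_heegnerField_h3_eq_one)
    (hGZ : ∀ (N : ℕ) [NeZero N] (W : WeierstrassCurve ℚ) (K : Type) [Field K] [NumberField K],
      gross_zagier N W K)
    (hKo : ∀ (N : ℕ) [NeZero N] (W : WeierstrassCurve ℚ) (K : Type) [Field K] [NumberField K],
      kolyvagin N W K)
    (hrat : ∀ (N : ℕ) [NeZero N] (W : WeierstrassCurve ℚ) (K : Type) [Field K] [NumberField K],
      heegnerPointComplex_mem_range_map N W K)
    (hCM0 : bsdTriple_of_hasCM_of_L_one_ne_zero) (hmod : hasEntireLFunction_rat)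
    (hCassels : bsdRHS_eq_of_isIsogenous)
    (hDt : ∃ Dt : ModularParametrizationData cremona75843b2 75843, ¬ (3 : ℤ) ∣ Dt.c)
    (hN : cremona75843b2.conductorNorm ℤ = 75843) :
    (BSDp cremona75843b2 3 ∧ cremona75843b2.ShaFinite ∧ cremona75843b2.analyticRank = 1 ∧
        cremona75843b2.mordellWeilRank = 1) ∧
      (BSDp cremona75843b1 3 ∧ cremona75843b1.analyticRank = 1) := by
  haveI : NeZero (75843 : ℕ) := ⟨by norm_num⟩
  refine record_of_family h h107 h94 hGZ hKo hrat hCM0 hmod hCassels 53 cremona75843b2 75843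
    cremona75843b2_eq hN ?_ (by norm_num) ?_ (by norm_num) hDt cremona75843b1 isIsogenous_cremona75843b
  · exact Or.inl ⟨by norm_num, squarefree_intCast_of_prime (by norm_num : Nat.Prime 53), by norm_num⟩
  · exact ⟨fun _ => by norm_num; exact threeClassNumberTrivial_neg159, fun h => absurd h (by norm_num)⟩

/-- **`87723n` (`d = 57`)**: `87723n2 = [0,0,1,0,−385] ≅ E_{57}`, `87723n1 ~ 87723n2`. Inputs `hDt`, `hN`.
(1) `57 = 3·19 ≡ 1 (4)`; `57 ≡ 3 (9)`; (3a) `h₃(−171) = 1` (the field is `ℚ(√−19)`, `h = 1`).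
[cite: KrizLi2019, Thm. 1.23 = Thm. 10.10 and Cor. 10.7 (2)] [cite: Cremona1997, ecdata/allcurves (class 87723n)] -/
theorem bsdp_three_cremona87723n_of_family
    (h : thm1010_bsdThree_overK_sexticTwist) (h107 : cor107_analyticRank_sexticTwist)
    (h94 : thm94_exists_heegnerField_h3_eq_one)
    (hGZ : ∀ (N : ℕ) [NeZero N] (W : WeierstrassCurve ℚ) (K : Type) [Field K] [NumberField K],
      gross_zagier N W K)
    (hKo : ∀ (N : ℕ) [NeZero N] (W : WeierstrassCurve ℚ) (K : Type) [Field K] [NumberField K],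
      kolyvagin N W K)
    (hrat : ∀ (N : ℕ) [NeZero N] (W : WeierstrassCurve ℚ) (K : Type) [Field K] [NumberField K],
      heegnerPointComplex_mem_range_map N W K)
    (hCM0 : bsdTriple_of_hasCM_of_L_one_ne_zero) (hmod : hasEntireLFunction_rat)
    (hCassels : bsdRHS_eq_of_isIsogenous)
    (hDt : ∃ Dt : ModularParametrizationData cremona87723n2 87723, ¬ (3 : ℤ) ∣ Dt.c)
    (hN : cremona87723n2.conductorNorm ℤ = 87723) :
    (BSDp cremona87723n2 3 ∧ cremona87723n2.ShaFinite ∧ cremona87723n2.analyticRank = 1 ∧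
        cremona87723n2.mordellWeilRank = 1) ∧
      (BSDp cremona87723n1 3 ∧ cremona87723n1.analyticRank = 1) := by
  haveI : NeZero (87723 : ℕ) := ⟨by norm_num⟩
  refine record_of_family h h107 h94 hGZ hKo hrat hCM0 hmod hCassels 57 cremona87723n2 87723
    cremona87723n2_eq hN ?_ (by norm_num) ?_ (by norm_num) hDt cremona87723n1 isIsogenous_cremona87723n
  · refine Or.inl ⟨by norm_num, ?_, by norm_num⟩
    have h57 : Squarefree ((3 * 19 : ℕ) : ℤ) :=
      Int.squarefree_natCast.mpr (squarefree_mul_of_prime Nat.prime_three (by norm_num) (by decide))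
    simpa using h57
  · exact ⟨fun _ => by norm_num; exact threeClassNumberTrivial_neg171, fun h => absurd h (by norm_num)⟩

/-- **`97344a` (`d = 104`)**: `97344a2 = [0,0,0,0,−702] ≅ E_{104}`, `97344a1 ~ 97344a2`. Inputs `hDt`, `hN`.
(1) `104 = 4·26`, `26 = 2·13 ≡ 2 (4)`; `104 ≡ 5 (9)`; (3a) `h₃(−312) = 1` (`h = 4`).
[cite: KrizLi2019, Thm. 1.23 = Thm. 10.10 and Cor. 10.7 (2)] [cite: Cremona1997, ecdata/allcurves (class 97344a)] -/
theorem bsdp_three_cremona97344a_of_family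
    (h : thm1010_bsdThree_overK_sexticTwist) (h107 : cor107_analyticRank_sexticTwist)
    (h94 : thm94_exists_heegnerField_h3_eq_one)
    (hGZ : ∀ (N : ℕ) [NeZero N] (W : WeierstrassCurve ℚ) (K : Type) [Field K] [NumberField K],
      gross_zagier N W K)
    (hKo : ∀ (N : ℕ) [NeZero N] (W : WeierstrassCurve ℚ) (K : Type) [Field K] [NumberField K],
      kolyvagin N W K)
    (hrat : ∀ (N : ℕ) [NeZero N] (W : WeierstrassCurve ℚ) (K : Type) [Field K] [NumberField K],
      heegnerPointComplex_mem_range_map N W K)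
    (hCM0 : bsdTriple_of_hasCM_of_L_one_ne_zero) (hmod : hasEntireLFunction_rat)
    (hCassels : bsdRHS_eq_of_isIsogenous)
    (hDt : ∃ Dt : ModularParametrizationData cremona97344a2 97344, ¬ (3 : ℤ) ∣ Dt.c)
    (hN : cremona97344a2.conductorNorm ℤ = 97344) :
    (BSDp cremona97344a2 3 ∧ cremona97344a2.ShaFinite ∧ cremona97344a2.analyticRank = 1 ∧
        cremona97344a2.mordellWeilRank = 1) ∧
      (BSDp cremona97344a1 3 ∧ cremona97344a1.analyticRank = 1) := by
  haveI : NeZero (97344 : ℕ) := ⟨by norm_num⟩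
  refine record_of_family h h107 h94 hGZ hKo hrat hCM0 hmod hCassels 104 cremona97344a2 97344
    cremona97344a2_eq hN ?_ (by norm_num) ?_ (by norm_num) hDt cremona97344a1 isIsogenous_cremona97344a
  · refine Or.inr ⟨by norm_num, by norm_num, ?_⟩
    rw [show ((104 : ℤ) / 4) = 26 by norm_num]
    have h26 : Squarefree ((2 * 13 : ℕ) : ℤ) :=
      Int.squarefree_natCast.mpr (squarefree_mul_of_prime Nat.prime_two (by norm_num) (by decide))
    simpa using h26
  · exact ⟨fun _ => by norm_num; exact threeClassNumberTrivial_neg312, fun h => absurd h (by norm_num)⟩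

/-- **`168507b` (`d = −79`)**: `168507b2 = [0,0,1,0,533] ≅ E_{−79}`, `168507b1 ~ 168507b2`. Inputs `hDt`,
`hN`. (1) `−79 ≡ 1 (4)` prime; case (2) `d < 0`, `−79 ≡ 2 (9)`; (3a) `h₃(−79) = 1` (`h = 5`).
[cite: KrizLi2019, Thm. 1.23 = Thm. 10.10 and Cor. 10.7 (2)] [cite: Cremona1997, ecdata/allcurves (class 168507b)] -/
theorem bsdp_three_cremona168507b_of_family
    (h : thm1010_bsdThree_overK_sexticTwist) (h107 : cor107_analyticRank_sexticTwist)
    (h94 : thm94_exists_heegnerField_h3_eq_one)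
    (hGZ : ∀ (N : ℕ) [NeZero N] (W : WeierstrassCurve ℚ) (K : Type) [Field K] [NumberField K],
      gross_zagier N W K)
    (hKo : ∀ (N : ℕ) [NeZero N] (W : WeierstrassCurve ℚ) (K : Type) [Field K] [NumberField K],
      kolyvagin N W K)
    (hrat : ∀ (N : ℕ) [NeZero N] (W : WeierstrassCurve ℚ) (K : Type) [Field K] [NumberField K],
      heegnerPointComplex_mem_range_map N W K)
    (hCM0 : bsdTriple_of_hasCM_of_L_one_ne_zero) (hmod : hasEntireLFunction_rat)
    (hCassels : bsdRHS_eq_of_isIsogenous)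
    (hDt : ∃ Dt : ModularParametrizationData cremona168507b2 168507, ¬ (3 : ℤ) ∣ Dt.c)
    (hN : cremona168507b2.conductorNorm ℤ = 168507) :
    (BSDp cremona168507b2 3 ∧ cremona168507b2.ShaFinite ∧ cremona168507b2.analyticRank = 1 ∧
        cremona168507b2.mordellWeilRank = 1) ∧
      (BSDp cremona168507b1 3 ∧ cremona168507b1.analyticRank = 1) := by
  haveI : NeZero (168507 : ℕ) := ⟨by norm_num⟩
  refine record_of_family h h107 h94 hGZ hKo hrat hCM0 hmod hCassels (-79) cremona168507b2 168507
    cremona168507b2_eq hN ?_ (by norm_num) ?_ (by norm_num) hDt cremona168507b1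
    isIsogenous_cremona168507b
  · exact Or.inl ⟨by norm_num,
      by simpa using squarefree_neg_natCast (by norm_num : Nat.Prime 79).squarefree, by norm_num⟩
  · exact ⟨fun h => absurd h (by norm_num), fun _ => threeClassNumberTrivial_neg79⟩

/-- **`176400jw` (`d = 140`)**: `176400jw2 = [0,0,0,0,−945] ≅ E_{140}`, `176400jw1 ~ 176400jw2`. Inputs
`hDt`, `hN`. (1) `140 = 4·35`, `35 = 5·7 ≡ 3 (4)`; `140 ≡ 5 (9)`; (3a) `h₃(−420) = 1` (`h = 8`).
[cite: KrizLi2019, Thm. 1.23 = Thm. 10.10 and Cor. 10.7 (2)] [cite: Cremona1997, ecdata/allcurves (class 176400jw)] -/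
theorem bsdp_three_cremona176400jw_of_family
    (h : thm1010_bsdThree_overK_sexticTwist) (h107 : cor107_analyticRank_sexticTwist)
    (h94 : thm94_exists_heegnerField_h3_eq_one)
    (hGZ : ∀ (N : ℕ) [NeZero N] (W : WeierstrassCurve ℚ) (K : Type) [Field K] [NumberField K],
      gross_zagier N W K)
    (hKo : ∀ (N : ℕ) [NeZero N] (W : WeierstrassCurve ℚ) (K : Type) [Field K] [NumberField K],
      kolyvagin N W K)
    (hrat : ∀ (N : ℕ) [NeZero N] (W : WeierstrassCurve ℚ) (K : Type) [Field K] [NumberField K],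
      heegnerPointComplex_mem_range_map N W K)
    (hCM0 : bsdTriple_of_hasCM_of_L_one_ne_zero) (hmod : hasEntireLFunction_rat)
    (hCassels : bsdRHS_eq_of_isIsogenous)
    (hDt : ∃ Dt : ModularParametrizationData cremona176400jw2 176400, ¬ (3 : ℤ) ∣ Dt.c)
    (hN : cremona176400jw2.conductorNorm ℤ = 176400) :
    (BSDp cremona176400jw2 3 ∧ cremona176400jw2.ShaFinite ∧ cremona176400jw2.analyticRank = 1 ∧
        cremona176400jw2.mordellWeilRank = 1) ∧
      (BSDp cremona176400jw1 3 ∧ cremona176400jw1.analyticRank = 1) := by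
  haveI : NeZero (176400 : ℕ) := ⟨by norm_num⟩
  refine record_of_family h h107 h94 hGZ hKo hrat hCM0 hmod hCassels 140 cremona176400jw2 176400
    cremona176400jw2_eq hN ?_ (by norm_num) ?_ (by norm_num) hDt cremona176400jw1
    isIsogenous_cremona176400jw
  · refine Or.inr ⟨by norm_num, by norm_num, ?_⟩
    rw [show ((140 : ℤ) / 4) = 35 by norm_num]
    have h35 : Squarefree ((5 * 7 : ℕ) : ℤ) :=
      Int.squarefree_natCast.mpr (squarefree_mul_of_prime Nat.prime_five (by norm_num) (by decide))
    simpa using h35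
  · exact ⟨fun _ => by norm_num; exact threeClassNumberTrivial_neg420, fun h => absurd h (by norm_num)⟩

end Summit.BirchSwinnertonDyer.Rank1Residual.X12.SexticTwistFamily

end
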